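import Summits.QuantumFields.YangMills.Theorems.FlatTubeReductionDiagonalRatioOnCore
import Summits.QuantumFields.YangMills.Theorems.FlatTubeReductionDiagonalMomentMeasurability
import HarnessLib

/-!
# The exact diagonal dressing on the concrete core WITHOUT integrability hypotheses: the Haar moments `M₂`, `M_R` and the level weight `Λ⁴` are bounded on the core, hence integrable
# against the reference density
# (route `FlatTubeReduction`, crux K1 `NearFlatRatioLaw` stmt-QuantumFields-24720; seat `ym-line-ftr-p1` g14; rate twin «ratepack-v3 / frozen fibres»; R2b1 RECORD rung — no summit
# statement is proved here)

WHY (memo `Cruxes/NearFlatRatioLaw/Lines/ratepack-v3-frozen-g12.md` §6.1 (F8b), integrability clause).  F8a `fpBOKernel_diag_two_sided_on_core` carries three `IntegrableOn` hypotheses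
(`ρ₁·M₂`, `ρ₁·M_R`, `ρ₁·Λ⁴` on the core `S′`).  They are automatic: on `S′` the level bounds of `…CoreLevelWeights` give `|X₁| ≤ a₁Λ`, `|X − X₁| ≤ a₂Λ + a_qQ` with
`a₁Λ + a₂Λ + a_qQ ≤ 1` (the `hsum` smallness), so `M₂ ≤ 1` (`haarMoment2_le`), `M_R ≤ e` (`haarMomentR_le`), `Λ⁴ ≤ (1+3T)⁴`; the moments are measurable (`measurable_haarMoment2/R`,
F6c) and `ρ₁` is bounded measurable, so `integrableOn_mul_of_bounded` applies on the finite product measure.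
  ★★★ `fpBOKernel_diag_two_sided_on_core'` — F8a with the hypotheses reduced to: profile data, window/level smallness, `hsum`, ONE moment number `Ξ`, the two tails `η`.
HONEST FRAMING: bookkeeping; femto rung R2b1 (RECORD label); not infinite volume, not a gap, not Clay.  No defs, no named facts, no `sorry`.
-/

set_option autoImplicit false

noncomputable section

open MeasureTheory Filter Topology Real Set
open scoped BigOperators
open Literature.MathematicalPhysics.QuantumFieldTheory
open Literature.MathematicalPhysics.QuantumLattice

namespace Summit.QuantumFields.YangMills.Theorems.FemtoTransferGap.RateTube

open Summit.QuantumFields.YangMills.Theorems.FemtoTransferGap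
open Summit.QuantumFields.YangMills.Theorems.FemtoTransferGap.TwoLattice
open Summit.QuantumFields.YangMills.Theorems.FemtoTransferGap.TwoLattice.ConstTube
open Summit.QuantumFields.YangMills.Theorems.FemtoTransferGap.TwoLattice.Avg
open Summit.QuantumFields.YangMills.Theorems.FemtoTransferGap.TwoLattice.Cov
open Summit.QuantumFields.YangMills.Theorems.FemtoTransferGap.TwoLattice.Toron
open Summit.QuantumFields.YangMills.Theorems.FemtoTransferGap.TwoLattice.Stiff (LinkSpace)

variable {L : ℕ} [NeZero L]

set_option maxHeartbeats 1600000 in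
/-- ★★★ **THE EXACT DIAGONAL DRESSING ON THE CONCRETE CORE, integrability discharged.**  Data and constants as in `fpBOKernel_diag_two_sided_on_core` (`β ≥ 1`; profile `Ω`
measurable, `0 ≤ Ω ≤ CΩ`, colour-blind, cap-supported; FP window `ε`; slow datum `u` with `orbitDist u ≤ 1/40`, `12L³orbitDist u⁴ < 2`; level `T` and fibre radius `r_T`;
the core `S′ = {βkin ≤ T} ∩ {β‖v̂‖² ≤ T} ∩ {β‖v̂′‖² ≤ T} ∩ supp`; `hsum`); given ONE moment number `∫_{S′}ρ₁Λ⁴ ≤ Ξ∫ρ₁` and the two tails `≤ η`: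
`(1 − (a₂+a_q)Ξ − η)f(1) ≤ f(u) ≤ (1 + (a₂+a_q)Ξ + e(a₁+a₂+a_q)²Ξ + η)f(1)`. [cite: Luscher1983, §3] -/
theorem fpBOKernel_diag_two_sided_on_core' {β : ℝ} (hβ : 1 ≤ β) {Ω : LinkSpace L → ℝ} (hΩm : Measurable Ω) {CΩ : ℝ} (hCΩ : ∀ x, |Ω x| ≤ CΩ) (hΩ0 : ∀ x, 0 ≤ Ω x)
    (hΩinv : ∀ (g : SU2) (x : LinkSpace L), Ω (adL L g x) = Ω x) (hΩc : ∀ v : Edge 3 L → Fin 3 → ℝ, Ω (linkEmbed L v) ≠ 0 → v ∈ capBalancedSet L)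
    (ε : ℝ) (u : GaugeConfig 3 1 SU2) (hu40 : orbitDist u ≤ 1 / 40) (hσ2 : (L : ℝ) ^ 3 * (12 * orbitDist u ^ 4) < 2)
    {T rT : ℝ} (hrT : ∀ r : ℝ, 0 ≤ r → β * r ^ 2 ≤ T → r ≤ rT) (hrT30 : rT + rT ≤ 1 / 30)
    (hsmallT : 3 * L * (Real.sqrt (T / β) + 5 * Real.sqrt 2 * rT + Real.sqrt 2 * rT) < 1)
    (hsum : (orbitDist u * (24 * ((Fintype.card (Edge 3 L) : ℝ) * (24302 * (L : ℝ) ^ 2 + 6 * (β * ε ^ 2))) + 80 * (Fintype.card (Plaquette 3 L × Fin 3) : ℝ)) +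
        (orbitDist u ^ 2 * (48 * ((Fintype.card (Edge 3 L) : ℝ) * (24302 * (L : ℝ) ^ 2 + 6 * (β * ε ^ 2))) + 72500000 * (Fintype.card (Plaquette 3 L × Fin 3) : ℝ)) +
          25 * ((L : ℝ) ^ 3 * (12 * orbitDist u ^ 4)) * (Fintype.card (Plaquette 3 L × Fin 3) : ℝ) + 3456 * (Fintype.card (Plaquette 3 L) : ℝ) * Real.sqrt ((L : ℝ) ^ 3 * (12 * orbitDist u ^ 4)))) *
        (1 + 3 * T) +
      4 * (Fintype.card (Plaquette 3 L) : ℝ) * (((L : ℝ) ^ 3 * (12 * orbitDist u ^ 4)) * (14688 * (Real.sqrt β)⁻¹ + 1401138 * β⁻¹) + 700000 * orbitDist u * (Real.sqrt β)⁻¹) *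
        (1 + 2 * T) ^ 2 ≤ 1)
    {Ξ η : ℝ}
    (hΞ : ∫ p in ({p : (Edge 3 L → Fin 3 → ℝ) × ((Edge 3 L → Fin 3 → ℝ) × (Site 3 L → SU2)) | β * kinDefect L (orthoTube L 1 p.1) (orthoTube L 1 p.2.1) p.2.2 ≤ T} ∩
          {p | β * ‖linkEmbed L p.1‖ ^ 2 ≤ T} ∩ {p | β * ‖linkEmbed L p.2.1‖ ^ 2 ≤ T} ∩
          {p | Ω (linkEmbed L p.1) ≠ 0 ∧ Ω (linkEmbed L p.2.1) ≠ 0 ∧ fpWeight L ε p.2.2 ≠ 0}),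
        fpTriple L β Ω (fpWeight L ε) 1 1 p * (1 + β * kinDefect L (orthoTube L 1 p.1) (orthoTube L 1 p.2.1) p.2.2 + β * ‖linkEmbed L p.1‖ ^ 2 + β * ‖linkEmbed L p.2.1‖ ^ 2) ^ 4
        ∂((orthoTransverse L).prod ((orthoTransverse L).prod (gaugeMeasure L))) ≤
      Ξ * ∫ p, fpTriple L β Ω (fpWeight L ε) 1 1 p ∂((orthoTransverse L).prod ((orthoTransverse L).prod (gaugeMeasure L))))
    (htail1 : ∫ p in ({p : (Edge 3 L → Fin 3 → ℝ) × ((Edge 3 L → Fin 3 → ℝ) × (Site 3 L → SU2)) | β * kinDefect L (orthoTube L 1 p.1) (orthoTube L 1 p.2.1) p.2.2 ≤ T} ∩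
          {p | β * ‖linkEmbed L p.1‖ ^ 2 ≤ T} ∩ {p | β * ‖linkEmbed L p.2.1‖ ^ 2 ≤ T} ∩
          {p | Ω (linkEmbed L p.1) ≠ 0 ∧ Ω (linkEmbed L p.2.1) ≠ 0 ∧ fpWeight L ε p.2.2 ≠ 0})ᶜ,
        fpTriple L β Ω (fpWeight L ε) 1 1 p ∂((orthoTransverse L).prod ((orthoTransverse L).prod (gaugeMeasure L))) ≤
      η * ∫ p, fpTriple L β Ω (fpWeight L ε) 1 1 p ∂((orthoTransverse L).prod ((orthoTransverse L).prod (gaugeMeasure L))))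
    (htailu : ∀ d : SU2, (∫ p in ({p : (Edge 3 L → Fin 3 → ℝ) × ((Edge 3 L → Fin 3 → ℝ) × (Site 3 L → SU2)) | β * kinDefect L (orthoTube L 1 p.1) (orthoTube L 1 p.2.1) p.2.2 ≤ T} ∩
          {p | β * ‖linkEmbed L p.1‖ ^ 2 ≤ T} ∩ {p | β * ‖linkEmbed L p.2.1‖ ^ 2 ≤ T} ∩
          {p | Ω (linkEmbed L p.1) ≠ 0 ∧ Ω (linkEmbed L p.2.1) ≠ 0 ∧ fpWeight L ε p.2.2 ≠ 0})ᶜ,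
        fpTriple L β Ω (fpWeight L ε) (gaugeTransform (fun _ : Site 3 1 => d) u) (gaugeTransform (fun _ : Site 3 1 => d) u) p
        ∂((orthoTransverse L).prod ((orthoTransverse L).prod (gaugeMeasure L)))) / transferKernel su2Rep ((L : ℝ) ^ 3 * β) u u ≤
      η * ((∫ p, fpTriple L β Ω (fpWeight L ε) 1 1 p ∂((orthoTransverse L).prod ((orthoTransverse L).prod (gaugeMeasure L)))) /
        transferKernel su2Rep ((L : ℝ) ^ 3 * β) (1 : GaugeConfig 3 1 SU2) 1)) :
    (1 - ((orbitDist u ^ 2 * (48 * ((Fintype.card (Edge 3 L) : ℝ) * (24302 * (L : ℝ) ^ 2 + 6 * (β * ε ^ 2))) + 72500000 * (Fintype.card (Plaquette 3 L × Fin 3) : ℝ)) +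
          25 * ((L : ℝ) ^ 3 * (12 * orbitDist u ^ 4)) * (Fintype.card (Plaquette 3 L × Fin 3) : ℝ) + 3456 * (Fintype.card (Plaquette 3 L) : ℝ) * Real.sqrt ((L : ℝ) ^ 3 * (12 * orbitDist u ^ 4))) +
        4 * (Fintype.card (Plaquette 3 L) : ℝ) * (((L : ℝ) ^ 3 * (12 * orbitDist u ^ 4)) * (14688 * (Real.sqrt β)⁻¹ + 1401138 * β⁻¹) + 700000 * orbitDist u * (Real.sqrt β)⁻¹)) * Ξ - η) *
        (fpBOKernel L β Ω (fpWeight L ε) 1 1 / transferKernel su2Rep ((L : ℝ) ^ 3 * β) (1 : GaugeConfig 3 1 SU2) 1) ≤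
        fpBOKernel L β Ω (fpWeight L ε) u u / transferKernel su2Rep ((L : ℝ) ^ 3 * β) u u ∧
      fpBOKernel L β Ω (fpWeight L ε) u u / transferKernel su2Rep ((L : ℝ) ^ 3 * β) u u ≤
        (1 + ((orbitDist u ^ 2 * (48 * ((Fintype.card (Edge 3 L) : ℝ) * (24302 * (L : ℝ) ^ 2 + 6 * (β * ε ^ 2))) + 72500000 * (Fintype.card (Plaquette 3 L × Fin 3) : ℝ)) +
            25 * ((L : ℝ) ^ 3 * (12 * orbitDist u ^ 4)) * (Fintype.card (Plaquette 3 L × Fin 3) : ℝ) + 3456 * (Fintype.card (Plaquette 3 L) : ℝ) * Real.sqrt ((L : ℝ) ^ 3 * (12 * orbitDist u ^ 4))) +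
          4 * (Fintype.card (Plaquette 3 L) : ℝ) * (((L : ℝ) ^ 3 * (12 * orbitDist u ^ 4)) * (14688 * (Real.sqrt β)⁻¹ + 1401138 * β⁻¹) + 700000 * orbitDist u * (Real.sqrt β)⁻¹)) * Ξ +
          Real.exp 1 * ((orbitDist u * (24 * ((Fintype.card (Edge 3 L) : ℝ) * (24302 * (L : ℝ) ^ 2 + 6 * (β * ε ^ 2))) + 80 * (Fintype.card (Plaquette 3 L × Fin 3) : ℝ))) +
            ((orbitDist u ^ 2 * (48 * ((Fintype.card (Edge 3 L) : ℝ) * (24302 * (L : ℝ) ^ 2 + 6 * (β * ε ^ 2))) + 72500000 * (Fintype.card (Plaquette 3 L × Fin 3) : ℝ)) +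
              25 * ((L : ℝ) ^ 3 * (12 * orbitDist u ^ 4)) * (Fintype.card (Plaquette 3 L × Fin 3) : ℝ) + 3456 * (Fintype.card (Plaquette 3 L) : ℝ) * Real.sqrt ((L : ℝ) ^ 3 * (12 * orbitDist u ^ 4)))) +
            4 * (Fintype.card (Plaquette 3 L) : ℝ) * (((L : ℝ) ^ 3 * (12 * orbitDist u ^ 4)) * (14688 * (Real.sqrt β)⁻¹ + 1401138 * β⁻¹) + 700000 * orbitDist u * (Real.sqrt β)⁻¹)) ^ 2 * Ξ + η) *
        (fpBOKernel L β Ω (fpWeight L ε) 1 1 / transferKernel su2Rep ((L : ℝ) ^ 3 * β) (1 : GaugeConfig 3 1 SU2) 1) := by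
  haveI := isFiniteMeasure_orthoTransverse L
  haveI : SecondCountableTopology SU2 := secondCountableTopology_su2
  have hβ0 : 0 < β := by linarith
  have hle := measurable_linkEmbed L
  -- abbreviations (as in F8a)
  set τu : ℝ := orbitDist u with hτu
  set σ : ℝ := (L : ℝ) ^ 3 * (12 * orbitDist u ^ 4) with hσdef
  set cK : ℝ := (Fintype.card (Edge 3 L) : ℝ) * (24302 * (L : ℝ) ^ 2 + 6 * (β * ε ^ 2)) with hcK
  set N3 : ℝ := (Fintype.card (Plaquette 3 L × Fin 3) : ℝ) with hN3
  set NP : ℝ := (Fintype.card (Plaquette 3 L) : ℝ) with hNP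
  set a₁ : ℝ := τu * (24 * cK + 80 * N3) with ha₁
  set a₂ : ℝ := τu ^ 2 * (48 * cK + 72500000 * N3) + 25 * σ * N3 + 3456 * NP * Real.sqrt σ with ha₂
  set aq : ℝ := 4 * NP * (σ * (14688 * (Real.sqrt β)⁻¹ + 1401138 * β⁻¹) + 700000 * τu * (Real.sqrt β)⁻¹) with haq
  -- the slow datum
  have hτu0 : 0 ≤ τu := orbitDist_nonneg u
  have hqu : ∀ k : Fin 3, ‖su2Quat (u (0, k)) - 1‖ ≤ τu := fun k => norm_su2Quat_sub_one_le_orbitDist u (0, k)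
  have hu2 : ∀ k : Fin 3, ∑ a, vecPart (u (0, k)) a ^ 2 ≤ τu ^ 2 := fun k =>
    (sum_sq_vecPart_le_norm_sub_one_sq (u (0, k))).trans (pow_le_pow_left₀ (norm_nonneg _) (hqu k) 2)
  have hS1 : (L : ℝ) ^ 3 * wilsonAction su2Rep u ≤ σ := by
    rw [hσdef]
    exact mul_le_mul_of_nonneg_left (wilsonAction_one_site_le u (fun e => by
      have : e = (0, e.2) := by ext <;> simp [Subsingleton.elim e.1 0]
      rw [this]; exact hqu e.2)) (by positivity)
  have hσ0 : 0 ≤ σ := by rw [hσdef]; positivity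
  have hcK0 : 0 ≤ cK := by rw [hcK]; positivity
  have hN30 : 0 ≤ N3 := Nat.cast_nonneg _
  have hNP0 : 0 ≤ NP := Nat.cast_nonneg _
  have hsβi : 0 ≤ (Real.sqrt β)⁻¹ := inv_nonneg.mpr (Real.sqrt_nonneg _)
  have hβi : 0 ≤ β⁻¹ := inv_nonneg.mpr hβ0.le
  have ha₁0 : 0 ≤ a₁ := by rw [ha₁]; positivity
  have ha₂0 : 0 ≤ a₂ := by rw [ha₂]; have := Real.sqrt_nonneg σ; positivity
  have haq0 : 0 ≤ aq := by rw [haq]; positivity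
  -- the core set is measurable
  have hNm := ((continuous_kinDefect_joint (L := L)).measurable.comp
    (((measurable_orthoTube_right (L := L) 1).comp measurable_fst).prodMk
      (((measurable_orthoTube_right (L := L) 1).comp (measurable_fst.comp measurable_snd)).prodMk (measurable_snd.comp measurable_snd)))).const_mul β
  have hA : MeasurableSet {p : (Edge 3 L → Fin 3 → ℝ) × ((Edge 3 L → Fin 3 → ℝ) × (Site 3 L → SU2)) | β * kinDefect L (orthoTube L 1 p.1) (orthoTube L 1 p.2.1) p.2.2 ≤ T} :=
    measurableSet_le hNm measurable_const
  have hB : MeasurableSet {p : (Edge 3 L → Fin 3 → ℝ) × ((Edge 3 L → Fin 3 → ℝ) × (Site 3 L → SU2)) | β * ‖linkEmbed L p.1‖ ^ 2 ≤ T} :=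
    measurableSet_le (((hle.comp measurable_fst).norm.pow_const 2).const_mul β) measurable_const
  have hC : MeasurableSet {p : (Edge 3 L → Fin 3 → ℝ) × ((Edge 3 L → Fin 3 → ℝ) × (Site 3 L → SU2)) | β * ‖linkEmbed L p.2.1‖ ^ 2 ≤ T} :=
    measurableSet_le (((hle.comp (measurable_fst.comp measurable_snd)).norm.pow_const 2).const_mul β) measurable_const
  have hD : MeasurableSet {p : (Edge 3 L → Fin 3 → ℝ) × ((Edge 3 L → Fin 3 → ℝ) × (Site 3 L → SU2)) | Ω (linkEmbed L p.1) ≠ 0 ∧ Ω (linkEmbed L p.2.1) ≠ 0 ∧ fpWeight L ε p.2.2 ≠ 0} := by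
    have h1 : Measurable fun p : (Edge 3 L → Fin 3 → ℝ) × ((Edge 3 L → Fin 3 → ℝ) × (Site 3 L → SU2)) => Ω (linkEmbed L p.1) := hΩm.comp (hle.comp measurable_fst)
    have h2 : Measurable fun p : (Edge 3 L → Fin 3 → ℝ) × ((Edge 3 L → Fin 3 → ℝ) × (Site 3 L → SU2)) => Ω (linkEmbed L p.2.1) :=
      hΩm.comp (hle.comp (measurable_fst.comp measurable_snd))
    have h3 : Measurable fun p : (Edge 3 L → Fin 3 → ℝ) × ((Edge 3 L → Fin 3 → ℝ) × (Site 3 L → SU2)) => fpWeight L ε p.2.2 :=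
      (measurable_fpWeight L ε).comp (measurable_snd.comp measurable_snd)
    exact ((h1 (measurableSet_singleton 0).compl).inter ((h2 (measurableSet_singleton 0).compl).inter (h3 (measurableSet_singleton 0).compl)))
  have hS := ((hA.inter hB).inter hC).inter hD
  -- pointwise data on the core
  have hcore : ∀ p ∈ ({p : (Edge 3 L → Fin 3 → ℝ) × ((Edge 3 L → Fin 3 → ℝ) × (Site 3 L → SU2)) | β * kinDefect L (orthoTube L 1 p.1) (orthoTube L 1 p.2.1) p.2.2 ≤ T} ∩
          {p | β * ‖linkEmbed L p.1‖ ^ 2 ≤ T} ∩ {p | β * ‖linkEmbed L p.2.1‖ ^ 2 ≤ T} ∩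
          {p | Ω (linkEmbed L p.1) ≠ 0 ∧ Ω (linkEmbed L p.2.1) ≠ 0 ∧ fpWeight L ε p.2.2 ≠ 0}),
      p.1 ∈ capBalancedSet L ∧ p.2.1 ∈ capBalancedSet L ∧ ‖linkEmbed L p.1‖ ≤ rT ∧ ‖linkEmbed L p.2.1‖ ≤ rT ∧ colourMean L p.2.2 ∈ fpBall ε ∧
        3 * L * (Real.sqrt (kinDefect L (orthoTube L 1 p.1) (orthoTube L 1 p.2.1) p.2.2) + 5 * Real.sqrt 2 * ‖linkEmbed L p.1‖ + Real.sqrt 2 * ‖linkEmbed L p.2.1‖) < 1 ∧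
        0 ≤ β * kinDefect L (orthoTube L 1 p.1) (orthoTube L 1 p.2.1) p.2.2 ∧ β * kinDefect L (orthoTube L 1 p.1) (orthoTube L 1 p.2.1) p.2.2 ≤ T ∧
        β * ‖linkEmbed L p.1‖ ^ 2 ≤ T ∧ β * ‖linkEmbed L p.2.1‖ ^ 2 ≤ T := by
    rintro p ⟨⟨⟨hpA, hpB⟩, hpC⟩, ⟨hv0, hv'0, hg0⟩⟩
    simp only [Set.mem_setOf_eq] at hpA hpB hpC
    have hvr : ‖linkEmbed L p.1‖ ≤ rT := hrT _ (norm_nonneg _) hpB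
    have hv'r : ‖linkEmbed L p.2.1‖ ≤ rT := hrT _ (norm_nonneg _) hpC
    have hkin : kinDefect L (orthoTube L 1 p.1) (orthoTube L 1 p.2.1) p.2.2 ≤ T / β := by
      rw [le_div_iff₀ hβ0]; linarith
    have hW : colourMean L p.2.2 ∈ fpBall ε := by
      by_contra hno; apply hg0; unfold fpWeight; rw [Set.indicator_of_notMem hno]
    have hsq : Real.sqrt (kinDefect L (orthoTube L 1 p.1) (orthoTube L 1 p.2.1) p.2.2) ≤ Real.sqrt (T / β) := Real.sqrt_le_sqrt hkin
    have hs2 : 0 ≤ Real.sqrt 2 := Real.sqrt_nonneg _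
    refine ⟨hΩc _ hv0, hΩc _ hv'0, hvr, hv'r, hW, ?_, mul_nonneg hβ0.le (kinDefect_nonneg _ _ _), hpA, hpB, hpC⟩
    have hL0 : (0 : ℝ) ≤ 3 * L := by positivity
    calc 3 * L * (Real.sqrt (kinDefect L (orthoTube L 1 p.1) (orthoTube L 1 p.2.1) p.2.2) + 5 * Real.sqrt 2 * ‖linkEmbed L p.1‖ + Real.sqrt 2 * ‖linkEmbed L p.2.1‖)
        ≤ 3 * L * (Real.sqrt (T / β) + 5 * Real.sqrt 2 * rT + Real.sqrt 2 * rT) := by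
          refine mul_le_mul_of_nonneg_left ?_ hL0
          nlinarith [hsq, hvr, hv'r, hs2]
      _ < 1 := hsmallT
  -- the two pointwise level bounds and the sup bound on the core, uniformly in `d`
  have hbd : ∀ p ∈ ({p : (Edge 3 L → Fin 3 → ℝ) × ((Edge 3 L → Fin 3 → ℝ) × (Site 3 L → SU2)) | β * kinDefect L (orthoTube L 1 p.1) (orthoTube L 1 p.2.1) p.2.2 ≤ T} ∩
          {p | β * ‖linkEmbed L p.1‖ ^ 2 ≤ T} ∩ {p | β * ‖linkEmbed L p.2.1‖ ^ 2 ≤ T} ∩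
          {p | Ω (linkEmbed L p.1) ≠ 0 ∧ Ω (linkEmbed L p.2.1) ≠ 0 ∧ fpWeight L ε p.2.2 ≠ 0}),
      (∀ d : SU2, |diagX1 L β (slowLin (gaugeTransform (fun _ : Site 3 1 => d) u)) p.1 p.2.1 p.2.2| ≤
        a₁ * (1 + β * kinDefect L (orthoTube L 1 p.1) (orthoTube L 1 p.2.1) p.2.2 + β * ‖linkEmbed L p.1‖ ^ 2 + β * ‖linkEmbed L p.2.1‖ ^ 2)) ∧
      (∀ d : SU2, |diagX L β (gaugeTransform (fun _ : Site 3 1 => d) u) p.1 p.2.1 p.2.2 - diagX1 L β (slowLin (gaugeTransform (fun _ : Site 3 1 => d) u)) p.1 p.2.1 p.2.2| ≤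
        a₂ * (1 + β * kinDefect L (orthoTube L 1 p.1) (orthoTube L 1 p.2.1) p.2.2 + β * ‖linkEmbed L p.1‖ ^ 2 + β * ‖linkEmbed L p.2.1‖ ^ 2) +
          aq * (1 + β * ‖linkEmbed L p.1‖ ^ 2 + β * ‖linkEmbed L p.2.1‖ ^ 2) ^ 2) ∧
      0 ≤ a₁ * (1 + β * kinDefect L (orthoTube L 1 p.1) (orthoTube L 1 p.2.1) p.2.2 + β * ‖linkEmbed L p.1‖ ^ 2 + β * ‖linkEmbed L p.2.1‖ ^ 2) ∧
      a₁ * (1 + β * kinDefect L (orthoTube L 1 p.1) (orthoTube L 1 p.2.1) p.2.2 + β * ‖linkEmbed L p.1‖ ^ 2 + β * ‖linkEmbed L p.2.1‖ ^ 2) +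
        (a₂ * (1 + β * kinDefect L (orthoTube L 1 p.1) (orthoTube L 1 p.2.1) p.2.2 + β * ‖linkEmbed L p.1‖ ^ 2 + β * ‖linkEmbed L p.2.1‖ ^ 2) +
          aq * (1 + β * ‖linkEmbed L p.1‖ ^ 2 + β * ‖linkEmbed L p.2.1‖ ^ 2) ^ 2) ≤ 1 ∧
      (1 + β * kinDefect L (orthoTube L 1 p.1) (orthoTube L 1 p.2.1) p.2.2 + β * ‖linkEmbed L p.1‖ ^ 2 + β * ‖linkEmbed L p.2.1‖ ^ 2) ^ 4 ≤ (1 + 3 * T) ^ 4 := by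
    intro p hp
    obtain ⟨hvc, hv'c, hvr, hv'r, hW, hsmall, hk0, hpA, hpB, hpC⟩ := hcore p hp
    have hrr : ‖linkEmbed L p.1‖ + ‖linkEmbed L p.2.1‖ ≤ 1 / 30 := by linarith
    have hv0 : 0 ≤ β * ‖linkEmbed L p.1‖ ^ 2 := by positivity
    have hv'0 : 0 ≤ β * ‖linkEmbed L p.2.1‖ ^ 2 := by positivity
    have hΛ0 : 0 ≤ 1 + β * kinDefect L (orthoTube L 1 p.1) (orthoTube L 1 p.2.1) p.2.2 + β * ‖linkEmbed L p.1‖ ^ 2 + β * ‖linkEmbed L p.2.1‖ ^ 2 := by linarith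
    have hΛ : 1 + β * kinDefect L (orthoTube L 1 p.1) (orthoTube L 1 p.2.1) p.2.2 + β * ‖linkEmbed L p.1‖ ^ 2 + β * ‖linkEmbed L p.2.1‖ ^ 2 ≤ 1 + 3 * T := by linarith
    have hQ : (1 + β * ‖linkEmbed L p.1‖ ^ 2 + β * ‖linkEmbed L p.2.1‖ ^ 2) ^ 2 ≤ (1 + 2 * T) ^ 2 := pow_le_pow_left₀ (by positivity) (by linarith) 2
    refine ⟨fun d => ?_, fun d => ?_, mul_nonneg ha₁0 hΛ0, ?_, pow_le_pow_left₀ hΛ0 hΛ 4⟩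
    · have h := diagX1_conj_le_levels (L := L) hβ0.le u hτu0 hu2 (sum_sq_le_one_of_cap L hvc.2) (sum_sq_le_one_of_cap L hv'c.2) hW hsmall d
      rw [ha₁, hcK, hN3]; exact h
    · have h := diagX_conj_sub_diagX1_le_levels (L := L) hβ u hτu0 hu40 hu2 hσ2 hσ0 hS1 hvc hv'c hrr hW hsmall d
      rw [ha₂, haq, hcK, hN3, hNP]; exact h
    · have h1 := mul_le_mul_of_nonneg_left hΛ ha₁0
      have h2 := mul_le_mul_of_nonneg_left hΛ ha₂0
      have h3 := mul_le_mul_of_nonneg_left hQ haq0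
      have hs : a₁ * (1 + 3 * T) + a₂ * (1 + 3 * T) + aq * (1 + 2 * T) ^ 2 ≤ 1 := by linarith [hsum]
      linarith
  -- the reference density is bounded measurable
  obtain ⟨Bρ, hBρ⟩ := abs_fpTriple_le (L := L) β hCΩ (abs_fpWeight_le L ε) (1 : GaugeConfig 3 1 SU2) 1
  have hBρ0 : 0 ≤ Bρ := (abs_nonneg _).trans (hBρ (0, 0, fun _ => 1))
  have hρm : Measurable fun p => fpTriple L β Ω (fpWeight L ε) 1 1 p := measurable_fpTriple β hΩm (measurable_fpWeight L ε) 1 1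
  -- the three integrability facts
  have hM₂i : IntegrableOn (fun p : (Edge 3 L → Fin 3 → ℝ) × ((Edge 3 L → Fin 3 → ℝ) × (Site 3 L → SU2)) => fpTriple L β Ω (fpWeight L ε) 1 1 p *
      ∫ d, |diagX L β (gaugeTransform (fun _ : Site 3 1 => d) u) p.1 p.2.1 p.2.2 - diagX1 L β (slowLin (gaugeTransform (fun _ : Site 3 1 => d) u)) p.1 p.2.1 p.2.2| ∂haarProbability SU2)
      ({p : (Edge 3 L → Fin 3 → ℝ) × ((Edge 3 L → Fin 3 → ℝ) × (Site 3 L → SU2)) | β * kinDefect L (orthoTube L 1 p.1) (orthoTube L 1 p.2.1) p.2.2 ≤ T} ∩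
          {p | β * ‖linkEmbed L p.1‖ ^ 2 ≤ T} ∩ {p | β * ‖linkEmbed L p.2.1‖ ^ 2 ≤ T} ∩
          {p | Ω (linkEmbed L p.1) ≠ 0 ∧ Ω (linkEmbed L p.2.1) ≠ 0 ∧ fpWeight L ε p.2.2 ≠ 0})
      ((orthoTransverse L).prod ((orthoTransverse L).prod (gaugeMeasure L))) := by
    refine integrableOn_mul_of_bounded hρm (measurable_haarMoment2 (L := L) β u) hBρ0 hBρ hS (fun p _ => integral_nonneg fun d => abs_nonneg _) (C := 1) fun p hp => ?_
    obtain ⟨_, h2, h10, hle1, _⟩ := hbd p hp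
    exact haarMoment2_le β u p.1 p.2.1 p.2.2 fun d => (h2 d).trans (by linarith)
  have hMRi : IntegrableOn (fun p : (Edge 3 L → Fin 3 → ℝ) × ((Edge 3 L → Fin 3 → ℝ) × (Site 3 L → SU2)) => fpTriple L β Ω (fpWeight L ε) 1 1 p *
      ∫ d, diagX L β (gaugeTransform (fun _ : Site 3 1 => d) u) p.1 p.2.1 p.2.2 ^ 2 * Real.exp |diagX L β (gaugeTransform (fun _ : Site 3 1 => d) u) p.1 p.2.1 p.2.2| ∂haarProbability SU2)
      ({p : (Edge 3 L → Fin 3 → ℝ) × ((Edge 3 L → Fin 3 → ℝ) × (Site 3 L → SU2)) | β * kinDefect L (orthoTube L 1 p.1) (orthoTube L 1 p.2.1) p.2.2 ≤ T} ∩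
          {p | β * ‖linkEmbed L p.1‖ ^ 2 ≤ T} ∩ {p | β * ‖linkEmbed L p.2.1‖ ^ 2 ≤ T} ∩
          {p | Ω (linkEmbed L p.1) ≠ 0 ∧ Ω (linkEmbed L p.2.1) ≠ 0 ∧ fpWeight L ε p.2.2 ≠ 0})
      ((orthoTransverse L).prod ((orthoTransverse L).prod (gaugeMeasure L))) := by
    refine integrableOn_mul_of_bounded hρm (measurable_haarMomentR (L := L) β u) hBρ0 hBρ hS
      (fun p _ => integral_nonneg fun d => mul_nonneg (sq_nonneg _) (Real.exp_pos _).le) (C := Real.exp 1) fun p hp => ?_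
    obtain ⟨h1, h2, h10, hle1, _⟩ := hbd p hp
    have h := haarMomentR_le β u p.1 p.2.1 p.2.2 h1 h2
    refine h.trans ?_
    have hE0 : 0 ≤ a₁ * (1 + β * kinDefect L (orthoTube L 1 p.1) (orthoTube L 1 p.2.1) p.2.2 + β * ‖linkEmbed L p.1‖ ^ 2 + β * ‖linkEmbed L p.2.1‖ ^ 2) +
        (a₂ * (1 + β * kinDefect L (orthoTube L 1 p.1) (orthoTube L 1 p.2.1) p.2.2 + β * ‖linkEmbed L p.1‖ ^ 2 + β * ‖linkEmbed L p.2.1‖ ^ 2) +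
          aq * (1 + β * ‖linkEmbed L p.1‖ ^ 2 + β * ‖linkEmbed L p.2.1‖ ^ 2) ^ 2) := (abs_nonneg _).trans ((abs_add_le _ _).trans (add_le_add (h1 1) (h2 1)) |>.trans le_rfl)
    calc _ ≤ (1 : ℝ) ^ 2 * Real.exp 1 := mul_le_mul (pow_le_pow_left₀ hE0 hle1 2) (Real.exp_le_exp.mpr hle1) (Real.exp_pos _).le (by positivity)
      _ = Real.exp 1 := by ring
  have hΛi : IntegrableOn (fun p : (Edge 3 L → Fin 3 → ℝ) × ((Edge 3 L → Fin 3 → ℝ) × (Site 3 L → SU2)) => fpTriple L β Ω (fpWeight L ε) 1 1 p *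
      (1 + β * kinDefect L (orthoTube L 1 p.1) (orthoTube L 1 p.2.1) p.2.2 + β * ‖linkEmbed L p.1‖ ^ 2 + β * ‖linkEmbed L p.2.1‖ ^ 2) ^ 4)
      ({p : (Edge 3 L → Fin 3 → ℝ) × ((Edge 3 L → Fin 3 → ℝ) × (Site 3 L → SU2)) | β * kinDefect L (orthoTube L 1 p.1) (orthoTube L 1 p.2.1) p.2.2 ≤ T} ∩
          {p | β * ‖linkEmbed L p.1‖ ^ 2 ≤ T} ∩ {p | β * ‖linkEmbed L p.2.1‖ ^ 2 ≤ T} ∩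
          {p | Ω (linkEmbed L p.1) ≠ 0 ∧ Ω (linkEmbed L p.2.1) ≠ 0 ∧ fpWeight L ε p.2.2 ≠ 0})
      ((orthoTransverse L).prod ((orthoTransverse L).prod (gaugeMeasure L))) := by
    have hΛm : Measurable fun p : (Edge 3 L → Fin 3 → ℝ) × ((Edge 3 L → Fin 3 → ℝ) × (Site 3 L → SU2)) =>
        (1 + β * kinDefect L (orthoTube L 1 p.1) (orthoTube L 1 p.2.1) p.2.2 + β * ‖linkEmbed L p.1‖ ^ 2 + β * ‖linkEmbed L p.2.1‖ ^ 2) ^ 4 :=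
      (((measurable_const.add hNm).add (((hle.comp measurable_fst).norm.pow_const 2).const_mul β)).add
        (((hle.comp (measurable_fst.comp measurable_snd)).norm.pow_const 2).const_mul β)).pow_const 4
    refine integrableOn_mul_of_bounded hρm hΛm hBρ0 hBρ hS (fun p hp => ?_) (C := (1 + 3 * T) ^ 4) fun p hp => (hbd p hp).2.2.2.2
    obtain ⟨-, -, -, -, -, -, hk0, -, -, -⟩ := hcore p hp
    positivity
  exact fpBOKernel_diag_two_sided_on_core (L := L) hβ hΩm hCΩ hΩ0 hΩinv hΩc ε u hu40 hσ2 hrT hrT30 hsmallT hsum hM₂i hMRi hΛi hΞ htail1 htailu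

end Summit.QuantumFields.YangMills.Theorems.FemtoTransferGap.RateTube

end
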